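import Literature.Combinatorics.Matroid.HeppBoundIdentities
import Literature.Combinatorics.Matroid.ShuffleChar
import Mathlib.Tactic.FieldSimp
import HarnessLib

/-!
# The Hepp sum of a direct sum; vanishing for disconnected matroids (Panzer 2022, Thm 2.19) — proved

Panzer 2022 [Panzer2022], §2.5: for a direct sum `M = A ⊕ B` the corank is additive,
`ℓ(γ) = ℓ(γ ∩ A) + ℓ(γ ∩ B)`, so the increments of `ω` along an ordering of `M` are the shuffle
of the increments along the induced orderings of `A` and of `B`, and the multiplicativity of
`Char` (Prop. 2.24) with `dChar(w) = |w| · Char(w)` gives the **product formula**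
`Hepp_D(A ⊕ B) = ω(A ⊕ B) · (Hepp_D(A)/ω(A)) · (Hepp_D(B)/ω(B))` (pointwise, off the poles), whence
**Thm 2.19** (the direction proved by shuffles): on the hyperplane `ω(A ⊕ B) = 0` of logarithmic
divergence the Hepp bound of a disconnected matroid vanishes.

We prove the product formula directly on orderings (first-edge recursion), for any set function
`ω` additive over `A ⊔ B`; the words of increments are read from the right (`suffixChar`,
`ShuffleChar.lean`), and no word-level shuffle is materialised: the induction IS the proof of
Prop. 2.24 transported to orderings.

## Contents

* first-edge bookkeeping on `orderings` (`cons_mem_orderings`, `tail_mem_orderings_erase`,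
  `sum_orderings_eq_sum_erase_cons`);
* `heppSumFn ω E` (the Hepp sum of a set function; `heppSumOfCorank ℓ E D a = heppSumFn ω E` for
  `ω = sdcOfCorank ℓ D a`), `sufWord ω r` (increments along suffixes), `charSum ω E`;
* `heppSumFn_eq_sum_suffixChar_tail` (the summand of an ordering is `dChar` of its increments),
  `charSum_eq_inv_mul_sum_charSum_erase`, `charSum_eq_inv_mul_heppSumFn`;
* `charSum_union` (Prop. 2.24 on orderings), **`heppSumFn_union`** (the product formula),
  **`heppSumFn_union_eq_zero`** (Thm 2.19, `⇐`, pointwise); the matroid form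
  `heppBoundDim_eq_zero_of_eq_disjointSum` is in `HeppBoundDisconnected.lean`.
-/

noncomputable section

open Finset

namespace Literature.Combinatorics.Matroid

variable {α : Type*} {𝕜 : Type*} [Field 𝕜]

/-! ### First-edge bookkeeping on orderings -/

/-- Prepending an edge `e ∈ E` to an ordering of `E ∖ e` gives an ordering of `E`. [folklore] -/
theorem cons_mem_orderings [DecidableEq α] {E : Finset α} {e : α} (he : e ∈ E) {l : List α}
    (hl : l ∈ orderings (E.erase e)) : e :: l ∈ orderings E := by
  rw [mem_orderings_iff] at hl ⊢
  rw [← Multiset.cons_coe, hl, Finset.erase_val, Multiset.cons_erase (Finset.mem_def.1 he)]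

/-- Dropping the first edge of an ordering of `E` leaves an ordering of `E` minus that edge. [folklore] -/
theorem tail_mem_orderings_erase [DecidableEq α] {E : Finset α} {l : List α}
    (hl : l ∈ orderings E) (h : l ≠ []) : l.tail ∈ orderings (E.erase (l.head h)) := by
  obtain ⟨x, r, rfl⟩ := List.exists_cons_of_ne_nil h
  rw [mem_orderings_iff] at hl ⊢
  rw [List.tail_cons, Finset.erase_val, ← hl, List.head_cons, ← Multiset.cons_coe,
    Multiset.erase_cons_head]

/-- The head of an ordering of `E` lies in `E`. [folklore] -/
theorem head_mem_of_mem_orderings {E : Finset α} {l : List α} (hl : l ∈ orderings E)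
    (h : l ≠ []) : l.head h ∈ E :=
  (mem_iff_of_mem_orderings hl).1 (List.head_mem h)

/-- **First-edge decomposition** of a sum over the orderings of a non-empty `E`. [folklore] -/
theorem sum_orderings_eq_sum_erase_cons [DecidableEq α] {β : Type*} [AddCommMonoid β]
    (E : Finset α) (hE : E.Nonempty) (f : List α → β) :
    ∑ l ∈ orderings E, f l = ∑ e ∈ E, ∑ l ∈ orderings (E.erase e), f (e :: l) := by
  rw [Finset.sum_sigma']
  refine Finset.sum_bij' (fun l hl => ⟨l.head (ne_nil_of_mem_orderings hl hE), l.tail⟩)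
    (fun x _ => x.1 :: x.2) ?_ ?_ ?_ ?_ ?_
  · intro l hl
    have hne := ne_nil_of_mem_orderings hl hE
    exact Finset.mem_sigma.2 ⟨head_mem_of_mem_orderings hl hne, tail_mem_orderings_erase hl hne⟩
  · rintro ⟨e, l⟩ hx
    rw [Finset.mem_sigma] at hx
    exact cons_mem_orderings hx.1 hx.2
  · intro l hl
    exact List.cons_head_tail (ne_nil_of_mem_orderings hl hE)
  · rintro ⟨e, l⟩ _
    rfl
  · intro l hl
    dsimp only
    rw [List.cons_head_tail]

/-! ### The Hepp sum of a set function; increments along suffixes -/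

/-- The Hepp sum of a set function `ω` on the orderings of `E`:
`Σ_σ Π_{k=1}^{N-1} ω(E^σ_k)⁻¹` (so that `heppSumOfCorank ℓ E D a` is the case
`ω = sdcOfCorank ℓ D a`). [cite: Panzer2022, Def. 2.4] -/
def heppSumFn [DecidableEq α] (ω : Finset α → 𝕜) (E : Finset α) : 𝕜 :=
  ∑ l ∈ orderings E, ∏ k ∈ Finset.Ico 1 E.card, (ω (l.take k).toFinset)⁻¹

/-- `heppSumOfCorank` is the Hepp sum of the set function `ω = sdcOfCorank ℓ D a`. [cite: Panzer2022, Def. 2.4] -/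
theorem heppSumOfCorank_eq_heppSumFn [DecidableEq α] (ℓ : Finset α → ℕ) (E : Finset α) (D : 𝕜)
    (a : α → 𝕜) : heppSumOfCorank ℓ E D a = heppSumFn (sdcOfCorank ℓ D a) E := rfl

/-- The **word of increments along the suffixes** of a list `r = [r₁, …, r_N]`:
letter `k` is `ω({r_k, …, r_N}) - ω({r_{k+1}, …, r_N})`; its suffix sums telescope to
`ω({r_k, …, r_N}) - ω(∅)` (Panzer's increments `Δω`, §2.5, read from the right). [cite: Panzer2022, §2.5 (increments Δω)] -/
def sufWord [DecidableEq α] (ω : Finset α → 𝕜) : List α → List 𝕜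
  | [] => []
  | x :: r => (ω (x :: r).toFinset - ω r.toFinset) :: sufWord ω r

/-- `sufWord ω [] = []`. [folklore] -/
@[simp] theorem sufWord_nil [DecidableEq α] (ω : Finset α → 𝕜) : sufWord ω [] = [] := rfl

/-- `sufWord ω (x :: r) = (ω(x r) - ω(r)) :: sufWord ω r`. [folklore] -/
@[simp] theorem sufWord_cons [DecidableEq α] (ω : Finset α → 𝕜) (x : α) (r : List α) :
    sufWord ω (x :: r) = (ω (x :: r).toFinset - ω r.toFinset) :: sufWord ω r := rfl

/-- Telescoping: the letters of `sufWord ω r` sum to `ω(r) - ω(∅)`. [folklore] -/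
theorem sum_sufWord [DecidableEq α] (ω : Finset α → 𝕜) :
    ∀ r : List α, (sufWord ω r).sum = ω r.toFinset - ω ∅
  | [] => by simp
  | x :: r => by
    rw [sufWord_cons, List.sum_cons, sum_sufWord ω r]
    ring

/-- A shift of indices: the proper final segments of `x :: r` are the final segments of `r`. [folklore] -/
theorem prod_Ico_one_drop_cons (f : List α → 𝕜) (x : α) (r : List α) :
    ∏ j ∈ Finset.Ico 1 (r.length + 1), f ((x :: r).drop j) =
      ∏ i ∈ Finset.range r.length, f (r.drop i) := by
  rw [Finset.prod_Ico_eq_prod_range, Nat.add_sub_cancel]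
  refine Finset.prod_congr rfl fun i _ => ?_
  rw [Nat.add_comm, List.drop_succ_cons]

/-- All final segments: `Π_{j=0}^{N-1} ω({r_{j+1}, …, r_N})⁻¹ = suffixChar (sufWord ω r)`
(`ω(∅) = 0`). [cite: Panzer2022, §2.5 (Char)] -/
theorem prod_inv_drop_eq_suffixChar [DecidableEq α] (ω : Finset α → 𝕜) (h0 : ω ∅ = 0) :
    ∀ r : List α, ∏ j ∈ Finset.range r.length, (ω (r.drop j).toFinset)⁻¹ =
      suffixChar (sufWord ω r)
  | [] => by simp
  | x :: r => by
    rw [List.length_cons, Finset.prod_range_succ', List.drop_zero, sufWord_cons, suffixChar_cons,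
      sum_sufWord ω r, h0, sub_zero, sub_add_cancel, ← prod_inv_drop_eq_suffixChar ω h0 r,
      mul_comm]
    simp only [List.drop_succ_cons]

/-- The summand of an ordering read from the right: `Π_{j=1}^{N-1} ω({r_{j+1}, …, r_N})⁻¹` is
`suffixChar` of the increment word with its first letter dropped (Panzer's `dChar(Δω)`),
provided `ω(∅) = 0`. [cite: Panzer2022, §2.5 (dChar)] -/
theorem prod_inv_drop_eq_suffixChar_tail [DecidableEq α] (ω : Finset α → 𝕜) (h0 : ω ∅ = 0) :
    ∀ r : List α, ∏ j ∈ Finset.Ico 1 r.length, (ω (r.drop j).toFinset)⁻¹ =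
      suffixChar (sufWord ω r).tail
  | [] => by simp
  | x :: r => by
    rw [sufWord_cons, List.tail_cons, List.length_cons,
      prod_Ico_one_drop_cons (fun t => (ω t.toFinset)⁻¹) x r, prod_inv_drop_eq_suffixChar ω h0 r]

/-- **The Hepp sum read from the right**: `heppSumFn ω E = Σ_{r} suffixChar((sufWord ω r).tail)`,
the sum over all orderings `r` of `E` of `dChar` of the increment word (reverse the ordering of
Def. 2.4: its initial segments are the final segments of the reversed one). Requires `ω(∅) = 0`. [cite: Panzer2022, §2.5 (Hepp bound = Σ dChar(Δω^σ))] -/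
theorem heppSumFn_eq_sum_suffixChar_tail [DecidableEq α] (ω : Finset α → 𝕜) (h0 : ω ∅ = 0)
    (E : Finset α) :
    heppSumFn ω E = ∑ r ∈ orderings E, suffixChar (sufWord ω r).tail := by
  unfold heppSumFn
  refine Finset.sum_nbij' (fun l => l.reverse) (fun l => l.reverse)
    (fun l hl => reverse_mem_orderings hl) (fun l hl => reverse_mem_orderings hl)
    (fun l _ => List.reverse_reverse l) (fun l _ => List.reverse_reverse l) ?_
  intro l hl
  have hlen := length_of_mem_orderings hl
  rw [← prod_inv_drop_eq_suffixChar_tail ω h0, List.length_reverse, hlen]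
  refine Finset.prod_nbij' (fun k => E.card - k) (fun k => E.card - k) ?_ ?_ ?_ ?_ ?_
  · intro k hk; simp only [Finset.mem_Ico] at hk ⊢; omega
  · intro k hk; simp only [Finset.mem_Ico] at hk ⊢; omega
  · intro k hk; simp only [Finset.mem_Ico] at hk; omega
  · intro k hk; simp only [Finset.mem_Ico] at hk; omega
  · intro k hk
    simp only [Finset.mem_Ico] at hk
    rw [List.drop_reverse, List.toFinset_reverse, hlen, Nat.sub_sub_self hk.2.le]

/-- The **`Char`-sum** of `E`: `Σ_r suffixChar(sufWord ω r)` over the orderings of `E`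
(`= Hepp_D(E)/ω(E)` by `charSum_eq_inv_mul_heppSumFn`; Panzer's `Σ_σ Char(Δω^σ)`). [cite: Panzer2022, §2.5 (Char)] -/
def charSum [DecidableEq α] (ω : Finset α → 𝕜) (E : Finset α) : 𝕜 :=
  ∑ r ∈ orderings E, suffixChar (sufWord ω r)

/-- `charSum ω ∅ = 1` (the empty ordering, `Char([]) = 1`). [folklore] -/
@[simp] theorem charSum_empty_eq_one [DecidableEq α] (ω : Finset α → 𝕜) : charSum ω ∅ = 1 := by
  have h : orderings (∅ : Finset α) = {[]} := by
    ext l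
    rw [mem_orderings_iff, Finset.mem_singleton, Finset.empty_val, Multiset.coe_eq_zero]
  simp [charSum, h]

/-- First-edge recursion of the `Char`-sum: `charSum(E) = ω(E)⁻¹ Σ_{e ∈ E} charSum(E ∖ e)` for
non-empty `E` (`Char(aα) = Char(a)/(|a|+α)` read from the right; `ω(∅) = 0`). [cite: Panzer2022, Prop. 2.24 (proof)] -/
theorem charSum_eq_inv_mul_sum_charSum_erase [DecidableEq α] (ω : Finset α → 𝕜) (h0 : ω ∅ = 0)
    (E : Finset α) (hE : E.Nonempty) :
    charSum ω E = (ω E)⁻¹ * ∑ e ∈ E, charSum ω (E.erase e) := by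
  rw [charSum, sum_orderings_eq_sum_erase_cons E hE, Finset.mul_sum]
  refine Finset.sum_congr rfl fun e he => ?_
  rw [charSum, Finset.mul_sum]
  refine Finset.sum_congr rfl fun l hl => ?_
  rw [sufWord_cons, suffixChar_cons, sum_sufWord, h0, sub_zero, sub_add_cancel,
    List.toFinset_cons, toFinset_eq_of_mem_orderings hl, Finset.insert_erase he]

/-- `charSum(E) = ω(E)⁻¹ · Hepp(E)`: `Char(w) = dChar(w)/|w|` summed over orderings (non-empty
`E`, `ω(∅) = 0`). [cite: Panzer2022, §2.5 (dChar = |w| Char)] -/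
theorem charSum_eq_inv_mul_heppSumFn [DecidableEq α] (ω : Finset α → 𝕜) (h0 : ω ∅ = 0)
    (E : Finset α) (hE : E.Nonempty) : charSum ω E = (ω E)⁻¹ * heppSumFn ω E := by
  rw [heppSumFn_eq_sum_suffixChar_tail ω h0, charSum, Finset.mul_sum]
  refine Finset.sum_congr rfl fun r hr => ?_
  obtain ⟨x, r', rfl⟩ := List.exists_cons_of_ne_nil (ne_nil_of_mem_orderings hr hE)
  rw [sufWord_cons, suffixChar_cons, List.tail_cons, sum_sufWord, h0, sub_zero, sub_add_cancel,
    toFinset_eq_of_mem_orderings hr]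

/-! ### Direct sums: the product formula and Thm 2.19 -/

/-- Additivity of `ω` over `A ⊔ B` passes to sub-unions `A' ⊔ B`, `A ⊔ B'`. [folklore] -/
theorem additive_mono [DecidableEq α] {ω : Finset α → 𝕜} {A B A' B' : Finset α}
    (hadd : ∀ X, X ⊆ A ∪ B → ω X = ω (X ∩ A) + ω (X ∩ B)) (hdisj : Disjoint A B)
    (hA : A' ⊆ A) (hB : B' ⊆ B) :
    ∀ X, X ⊆ A' ∪ B' → ω X = ω (X ∩ A') + ω (X ∩ B') := by
  intro X hX
  have hXA : X ∩ A = X ∩ A' := by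
    ext x
    simp only [Finset.mem_inter, and_congr_right_iff]
    intro hx
    refine ⟨fun hxA => ?_, fun h => hA h⟩
    rcases Finset.mem_union.1 (hX hx) with h | h
    · exact h
    · exact absurd (Finset.disjoint_left.1 hdisj hxA) (fun h' => h' (hB h))
  have hXB : X ∩ B = X ∩ B' := by
    ext x
    simp only [Finset.mem_inter, and_congr_right_iff]
    intro hx
    refine ⟨fun hxB => ?_, fun h => hB h⟩
    rcases Finset.mem_union.1 (hX hx) with h | h
    · exact absurd (Finset.disjoint_left.1 hdisj (hA h)) (fun h' => h' hxB)
    · exact h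
  rw [hadd X (hX.trans (Finset.union_subset_union hA hB)), hXA, hXB]

/-- For `ω` additive over `A ⊔ B` with `ω(∅) = 0`: `ω(A ∪ B) = ω(A) + ω(B)`. [folklore] -/
theorem additive_union [DecidableEq α] {ω : Finset α → 𝕜} {A B : Finset α}
    (hadd : ∀ X, X ⊆ A ∪ B → ω X = ω (X ∩ A) + ω (X ∩ B)) (hdisj : Disjoint A B) :
    ω (A ∪ B) = ω A + ω B := by
  rw [hadd _ subset_rfl, Finset.union_inter_cancel_left]
  congr 1
  rw [Finset.inter_comm, Finset.inter_union_distrib_left, Finset.inter_self,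
    Finset.disjoint_iff_inter_eq_empty.1 hdisj.symm, Finset.empty_union]

/-- **`Char` is multiplicative over a direct sum** (Panzer 2022, Prop. 2.24 transported to
orderings, as in the proof of Thm 2.19): if `ω` (with `ω(∅) = 0`) is additive over the disjoint
union `A ⊔ B` (`ω(X) = ω(X ∩ A) + ω(X ∩ B)`, e.g. `ω = sdc` of a direct sum of matroids, whose
corank is additive) and no `ω(A' ∪ B')` with `A' ⊆ A`, `B' ⊆ B`, `A' ∪ B' ≠ ∅` vanishes, then
`charSum(A ∪ B) = charSum(A) · charSum(B)`. Proof as printed: first-edge recursion and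
`ω(A ∪ B)⁻¹ (ω(A) + ω(B)) = 1`. [cite: Panzer2022, Prop. 2.24 and Thm 2.19 (proof)] -/
theorem charSum_union [DecidableEq α] (ω : Finset α → 𝕜) (h0 : ω ∅ = 0) :
    ∀ (n : ℕ) (A B : Finset α), (A ∪ B).card = n → Disjoint A B →
      (∀ X, X ⊆ A ∪ B → ω X = ω (X ∩ A) + ω (X ∩ B)) →
      (∀ A', A' ⊆ A → ∀ B', B' ⊆ B → (A' ∪ B').Nonempty → ω (A' ∪ B') ≠ 0) →
        charSum ω (A ∪ B) = charSum ω A * charSum ω B := by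
  intro n
  induction n using Nat.strong_induction_on with
  | _ n ih =>
    intro A B hn hdisj hadd hne0
    rcases A.eq_empty_or_nonempty with rfl | hA
    · simp
    rcases B.eq_empty_or_nonempty with rfl | hB
    · simp
    have hAB : (A ∪ B).Nonempty := hA.mono Finset.subset_union_left
    have hωA : ω A ≠ 0 := by
      simpa using hne0 A subset_rfl ∅ (Finset.empty_subset _) (by simpa using hA)
    have hωB : ω B ≠ 0 := by
      simpa using hne0 ∅ (Finset.empty_subset _) B subset_rfl (by simpa using hB)
    have hωAB : ω (A ∪ B) ≠ 0 := hne0 A subset_rfl B subset_rfl hAB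
    have haddAB : ω (A ∪ B) = ω A + ω B := additive_union hadd hdisj
    -- first-edge recursion on `A ∪ B`, on `A` and on `B`
    rw [charSum_eq_inv_mul_sum_charSum_erase ω h0 (A ∪ B) hAB, Finset.sum_union hdisj]
    have hSA : ∑ x ∈ A, charSum ω ((A ∪ B).erase x) = ω A * charSum ω A * charSum ω B := by
      rw [charSum_eq_inv_mul_sum_charSum_erase ω h0 A hA, ← mul_assoc, mul_inv_cancel₀ hωA, one_mul,
        Finset.sum_mul]
      refine Finset.sum_congr rfl fun x hx => ?_
      have hxB : x ∉ B := Finset.disjoint_left.1 hdisj hx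
      have hEq : (A ∪ B).erase x = A.erase x ∪ B := by
        rw [Finset.erase_union_distrib, Finset.erase_eq_of_notMem hxB]
      rw [hEq]
      have hlt : (A.erase x ∪ B).card < n := by
        rw [← hEq, Finset.card_erase_of_mem (Finset.mem_union_left B hx)]
        have := Finset.card_pos.2 hAB
        omega
      refine ih _ hlt
        (A.erase x) B rfl (Finset.disjoint_of_subset_left (Finset.erase_subset x A) hdisj)
        (additive_mono hadd hdisj (Finset.erase_subset x A) subset_rfl)
        (fun A' hA' B' hB' hne => hne0 A' (hA'.trans (Finset.erase_subset x A)) B' hB' hne)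
    have hSB : ∑ x ∈ B, charSum ω ((A ∪ B).erase x) = ω B * charSum ω A * charSum ω B := by
      rw [charSum_eq_inv_mul_sum_charSum_erase ω h0 B hB, mul_assoc, mul_left_comm (charSum ω A),
        ← mul_assoc, mul_inv_cancel₀ hωB, one_mul, Finset.mul_sum]
      refine Finset.sum_congr rfl fun x hx => ?_
      have hxA : x ∉ A := fun h => Finset.disjoint_left.1 hdisj h hx
      have hEq : (A ∪ B).erase x = A ∪ B.erase x := by
        rw [Finset.erase_union_distrib, Finset.erase_eq_of_notMem hxA]
      rw [hEq]
      have hlt : (A ∪ B.erase x).card < n := by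
        rw [← hEq, Finset.card_erase_of_mem (Finset.mem_union_right A hx)]
        have := Finset.card_pos.2 hAB
        omega
      exact ih _ hlt
        A (B.erase x) rfl (Finset.disjoint_of_subset_right (Finset.erase_subset x B) hdisj)
        (additive_mono hadd hdisj subset_rfl (Finset.erase_subset x B))
        (fun A' hA' B' hB' hne => hne0 A' hA' B' (hB'.trans (Finset.erase_subset x B)) hne)
    rw [hSA, hSB, haddAB]
    rw [haddAB] at hωAB
    field_simp

/-- **The product formula for a direct sum** (Panzer 2022, proof of Thm 2.19 with Prop. 2.24 and
`dChar = |·| Char`): for non-empty disjoint `A`, `B` and `ω` additive over `A ⊔ B` with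
`ω(∅) = 0`, off the poles of all PROPER sub-unions,
`Hepp(A ∪ B) = ω(A ∪ B) · charSum(A) · charSum(B)`, i.e.
`Hepp_D(A ⊕ B) = ω(A ⊕ B) · (Hepp_D(A)/ω(A)) · (Hepp_D(B)/ω(B))`
(`charSum_eq_inv_mul_heppSumFn`). No hypothesis on `ω(A ∪ B)` itself. [cite: Panzer2022, Thm 2.19 (proof)] -/
theorem heppSumFn_union [DecidableEq α] (ω : Finset α → 𝕜) (h0 : ω ∅ = 0) (A B : Finset α)
    (hA : A.Nonempty) (hB : B.Nonempty) (hdisj : Disjoint A B)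
    (hadd : ∀ X, X ⊆ A ∪ B → ω X = ω (X ∩ A) + ω (X ∩ B))
    (hne0 : ∀ A', A' ⊆ A → ∀ B', B' ⊆ B → (A' ∪ B').Nonempty → A' ∪ B' ≠ A ∪ B →
      ω (A' ∪ B') ≠ 0) :
    heppSumFn ω (A ∪ B) = ω (A ∪ B) * charSum ω A * charSum ω B := by
  have hAB : (A ∪ B).Nonempty := hA.mono Finset.subset_union_left
  -- `A` and `B` are proper sub-unions
  have hApr : A ≠ A ∪ B := by
    intro h
    obtain ⟨b, hb⟩ := hB
    have : b ∈ A := by rw [h]; exact Finset.mem_union_right A hb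
    exact Finset.disjoint_left.1 hdisj this hb
  have hBpr : B ≠ A ∪ B := by
    intro h
    obtain ⟨x, hx⟩ := hA
    have : x ∈ B := by rw [h]; exact Finset.mem_union_left B hx
    exact Finset.disjoint_left.1 hdisj hx this
  have hωA : ω A ≠ 0 := by
    simpa using hne0 A subset_rfl ∅ (Finset.empty_subset _) (by simpa using hA) (by simpa using hApr)
  have hωB : ω B ≠ 0 := by
    simpa using hne0 ∅ (Finset.empty_subset _) B subset_rfl (by simpa using hB) (by simpa using hBpr)
  rw [heppSumFn_eq_sum_suffixChar_tail ω h0, sum_orderings_eq_sum_erase_cons (A ∪ B) hAB,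
    Finset.sum_union hdisj]
  -- after dropping the first edge `x`, the summand is `Char` of an ordering of `(A ∪ B) ∖ x`
  have hinner : ∀ x ∈ A ∪ B, ∑ l ∈ orderings ((A ∪ B).erase x),
      suffixChar (sufWord ω (x :: l)).tail = charSum ω ((A ∪ B).erase x) := by
    intro x _
    rfl
  rw [Finset.sum_congr rfl fun x hx => hinner x (Finset.mem_union_left B hx),
    Finset.sum_congr rfl fun x hx => hinner x (Finset.mem_union_right A hx)]
  have hSA : ∑ x ∈ A, charSum ω ((A ∪ B).erase x) = ω A * charSum ω A * charSum ω B := by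
    rw [charSum_eq_inv_mul_sum_charSum_erase ω h0 A hA, ← mul_assoc, mul_inv_cancel₀ hωA, one_mul,
      Finset.sum_mul]
    refine Finset.sum_congr rfl fun x hx => ?_
    have hxB : x ∉ B := Finset.disjoint_left.1 hdisj hx
    have hEq : (A ∪ B).erase x = A.erase x ∪ B := by
      rw [Finset.erase_union_distrib, Finset.erase_eq_of_notMem hxB]
    rw [hEq]
    refine charSum_union ω h0 _ (A.erase x) B rfl
      (Finset.disjoint_of_subset_left (Finset.erase_subset x A) hdisj)
      (additive_mono hadd hdisj (Finset.erase_subset x A) subset_rfl)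
      (fun A' hA' B' hB' hne => hne0 A' (hA'.trans (Finset.erase_subset x A)) B' hB' hne ?_)
    intro hEq'
    have : x ∈ A' ∪ B' := by rw [hEq']; exact Finset.mem_union_left B hx
    rcases Finset.mem_union.1 this with h | h
    · exact (Finset.notMem_erase x A) (hA' h)
    · exact hxB (hB' h)
  have hSB : ∑ x ∈ B, charSum ω ((A ∪ B).erase x) = ω B * charSum ω A * charSum ω B := by
    rw [charSum_eq_inv_mul_sum_charSum_erase ω h0 B hB, mul_assoc, mul_left_comm (charSum ω A),
      ← mul_assoc, mul_inv_cancel₀ hωB, one_mul, Finset.mul_sum]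
    refine Finset.sum_congr rfl fun x hx => ?_
    have hxA : x ∉ A := fun h => Finset.disjoint_left.1 hdisj h hx
    have hEq : (A ∪ B).erase x = A ∪ B.erase x := by
      rw [Finset.erase_union_distrib, Finset.erase_eq_of_notMem hxA]
    rw [hEq]
    refine charSum_union ω h0 _ A (B.erase x) rfl
      (Finset.disjoint_of_subset_right (Finset.erase_subset x B) hdisj)
      (additive_mono hadd hdisj subset_rfl (Finset.erase_subset x B))
      (fun A' hA' B' hB' hne => hne0 A' hA' B' (hB'.trans (Finset.erase_subset x B)) hne ?_)
    intro hEq'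
    have : x ∈ A' ∪ B' := by rw [hEq']; exact Finset.mem_union_right A hx
    rcases Finset.mem_union.1 this with h | h
    · exact hxA (hA' h)
    · exact (Finset.notMem_erase x B) (hB' h)
  rw [hSA, hSB, additive_union hadd hdisj]
  ring

/-- **Thm 2.19 (the direction by shuffles), pointwise**: on the hyperplane `ω(A ⊔ B) = 0` of
logarithmic divergence the Hepp sum of a direct sum vanishes (Panzer 2022, Thm 2.19 with
Lemma 2.23: "disconnectedness is sufficient to ensure `H(M, a⃗) = 0`"), off the poles of the
proper sub-unions. [cite: Panzer2022, Thm 2.19] -/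
theorem heppSumFn_union_eq_zero [DecidableEq α] (ω : Finset α → 𝕜) (h0 : ω ∅ = 0)
    (A B : Finset α) (hA : A.Nonempty) (hB : B.Nonempty) (hdisj : Disjoint A B)
    (hadd : ∀ X, X ⊆ A ∪ B → ω X = ω (X ∩ A) + ω (X ∩ B))
    (hne0 : ∀ A', A' ⊆ A → ∀ B', B' ⊆ B → (A' ∪ B').Nonempty → A' ∪ B' ≠ A ∪ B →
      ω (A' ∪ B') ≠ 0)
    (hlog : ω (A ∪ B) = 0) : heppSumFn ω (A ∪ B) = 0 := by
  rw [heppSumFn_union ω h0 A B hA hB hdisj hadd hne0, hlog, zero_mul, zero_mul]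

end Literature.Combinatorics.Matroid
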